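import Summits.CriticalPhenomena.PercolationContinuityZ3.Theorems.PercNearOneGluingNoHeavyQuantPolylogChiFace
import Summits.CriticalPhenomena.PercolationContinuityZ3.Theorems.PercNearOneGluingNoHeavyQuantThetaSubcriticalChi
import HarnessLib

/-!
# QUANT lane / PAPER-2 rate track (ARM-1, gen 11): corollaries of FACE E — the master transfer at the BALANCED scale
# (`P_{p_c}(|C(0)| ≥ n) ≤ (2/κ² + K_d)·[s²χ(p_c−s)]_{s = κ n^{−1/2}}`, unconditional), and FACE E ⟹ the `1/log`-MODULUS of `θ` with the
# same exponent (p4's `θ(p_c+s) ≤ K_d s²χ(p_c−s)`): ONE function `ω(s) = s²χ(p_c − s)` controls both `θ` above `p_c` and the volume tail at `p_c`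

builds on p205010 (kernel theorem, internal audit signed; external expert review pending)

Cell `prim-quant`, seat `prim-quant-arm-1` (rate-theorem architect), memo `run/shared/lean/prim/quant/RATE-PLAN.md` §20.3.  Proof-only, no
definitions.  Companion of `…QuantPolylogChiFace` (FACE E ⟹ the polylog rung): the SAME subcritical hypothesis controls `θ` above `p_c`
through p4's two-sided inequality `ThetaModulus.theta_le_sq_mul_chi_critical` (`θ(p) ≤ (256d/(p_c(1−p_c)²)) s² χ(p_c − s)` for
`p_c ≤ p ≤ p_c + s`, Hutchcroft's entropy bound with `n → ∞`), read at `s = p − p_c`: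

* **`Quant.real_clusterSizeGe_criticalProbI_le_susceptibilityDefect`** (`d ≥ 2`, unconditional): for every `n ≥ 1` and every
  `0 < κ ≤ min(p_c,1−p_c)/4`, with `s = κ n^{−1/2}`: `P_{p_c}(|C(0)| ≥ n) ≤ (2/κ² + 256d/(p_c(1−p_c)²))·s²·χ(p_c − s)` — the master transfer of
  `…QuantPolylogChiFace` at the balanced scale (`2χ/n = (2/κ²)s²χ`).  With p4's `θ(p) ≤ (256d/(p_c(1−p_c)²)) s² χ(p_c−s)` (`p_c ≤ p ≤ p_c+s`) this says:
  the single near-critical function `ω(s) := s²χ(p_c−s)` bounds BOTH `θ(p_c + s)` AND `P_{p_c}(|C(0)| ≥ κ²/s²)`; any explicit rate `ω(s) → 0` is at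
  once a modulus of `θ` (T2-type) and a volume/one-arm rate at `p_c` (rung-type) — power (`γ′ < 2`: routes C / p4), polylog (FACE E), or log*; none is
  known for `3 ≤ d ≤ 6` (`ω → 0` itself is Hutchcroft's open continuity criterion there).
* **`Quant.logModulus_of_chiLogTwo`** (`d ≥ 2`): `χ(q) ≤ M(p_c−q)^{−2}(log(1/(p_c−q)))^{−c}` on `(p_c−δ₀, p_c)` ⟹ for `p_c < p ≤ p_c + s₀`,
  `s₀ = min(δ₀, p_c, 1−p_c)/2`: `θ(p) ≤ (256d/(p_c(1−p_c)²)) M (log(1/(p−p_c)))^{−c}` — the first conjunct of FACE B′, SAME `c`.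

So in the lattice of RATE-PLAN §20.4 the node "log-corrected `γ′ = 2`" sits above BOTH the polylog rung (c) and the `1/log`-modulus (c) — exactly as
route C's `γ′ < 2` sits above both (T1) and (T2) (`Quant.rates_of_chiSubcritical`).  CONDITIONAL; hypothesis open for `3 ≤ d ≤ 6`; nothing here is
a rate.  [cite: Hutchcroft2022Triangle, Thm. 1.3 and §1.1] [cite: Grimmett1999, §10.2]
-/

noncomputable section

namespace Summit.CriticalPhenomena.PercolationContinuityZ3.Theorems.Quant

open MeasureTheory Literature.Probability.Percolation Literature.Probability.LatticeModels

variable {d : ℕ}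

/-- **The master transfer at the balanced scale** (`d ≥ 2`, unconditional): for `n ≥ 1`, `0 < κ ≤ min(p_c, 1−p_c)/4` and `s = κ n^{−1/2}`,
`P_{p_c}(|C(0)| ≥ n) ≤ (2/κ² + 256d/(p_c(1−p_c)²)) · s² · χ(p_c − s)` (`…ChiFace`'s `real_clusterSizeGe_criticalProbI_le_chi` at `q = p_c − s`, using
`1/n = s²/κ²`).  The volume tail at `p_c` and (p4) `θ` just above `p_c` are controlled by the same function `s ↦ s²χ(p_c−s)`.
[cite: Hutchcroft2022Triangle, Thm. 1.3 and §1.1] -/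
theorem real_clusterSizeGe_criticalProbI_le_susceptibilityDefect (hd : 2 ≤ d) {κ : ℝ} (hκ0 : 0 < κ)
    (hκ : κ ≤ min (criticalProbI d : ℝ) (1 - criticalProbI d) / 4) {n : ℕ} (hn : 1 ≤ n)
    (q : unitInterval) (hq : (q : ℝ) = criticalProbI d - κ * (n : ℝ) ^ (-(1 / 2 : ℝ))) :
    (bondPercolation (zdGraph d) (criticalProbI d)).real (clusterSizeGe (0 : Site d) n) ≤
      (2 / κ ^ 2 + 256 * d / ((criticalProbI d : ℝ) * (1 - criticalProbI d) ^ 2)) *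
        (κ * (n : ℝ) ^ (-(1 / 2 : ℝ))) ^ 2 * chi d q := by
  set pc : ℝ := (criticalProbI d : ℝ) with hpcdef
  have hd1 : 1 ≤ d := by omega
  have hpc0 : 0 < pc := by rw [hpcdef, coe_criticalProbI]; exact criticalProb_zd_pos d hd1
  have hpc1 : pc < 1 := by rw [hpcdef, coe_criticalProbI]; exact criticalProb_zd_lt_one hd
  have hn0 : (0 : ℝ) < n := by exact_mod_cast (show 0 < n by omega)
  have hn1 : (1 : ℝ) ≤ n := by exact_mod_cast hn
  set a : ℝ := (n : ℝ) ^ (-(1 / 2 : ℝ)) with ha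
  have ha0 : 0 < a := Real.rpow_pos_of_pos hn0 _
  have ha1 : a ≤ 1 := Real.rpow_le_one_of_one_le_of_nonpos hn1 (by norm_num)
  set s₁ : ℝ := κ * a with hs₁
  have hs0 : 0 < s₁ := mul_pos hκ0 ha0
  have hsκ : s₁ ≤ κ := mul_le_of_le_one_right hκ0.le ha1
  have hm1 : min pc (1 - pc) ≤ pc := min_le_left _ _
  have hm2 : min pc (1 - pc) ≤ 1 - pc := min_le_right _ _
  have hq1 : pc - min (pc / 2) ((1 - pc) / 2) < q := by
    rw [hq]
    have : min (pc / 2) ((1 - pc) / 2) = min pc (1 - pc) / 2 := by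
      rcases le_total pc (1 - pc) with h | h
      · rw [min_eq_left (by linarith : pc / 2 ≤ (1 - pc) / 2), min_eq_left h]
      · rw [min_eq_right (by linarith : (1 - pc) / 2 ≤ pc / 2), min_eq_right h]
    rw [this]
    have hmin0 : 0 < min pc (1 - pc) := lt_min hpc0 (by linarith)
    show pc - min pc (1 - pc) / 2 < pc - κ * a
    nlinarith
  have hq2 : (q : ℝ) < pc := by rw [hq]; show pc - κ * a < pc; nlinarith
  have hmaster := real_clusterSizeGe_criticalProbI_le_chi hd q hq1 hq2 hn
  have hgap : pc - (q : ℝ) = s₁ := by rw [hq]; show pc - (pc - κ * a) = κ * a; ring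
  rw [hgap] at hmaster
  -- `1/n = a²`, so `2χ/n = (2/κ²) s₁² χ`
  have ha2 : a ^ 2 = 1 / n := by
    have h2 : a ^ 2 = (n : ℝ) ^ ((-(1 / 2 : ℝ)) * ((2 : ℕ) : ℝ)) := by rw [ha, Real.rpow_mul_natCast hn0.le]
    rw [h2, show (-(1 / 2 : ℝ)) * ((2 : ℕ) : ℝ) = -1 by norm_num, Real.rpow_neg_one, one_div]
  have hχ0 : 0 ≤ chi d q :=
    le_trans zero_le_one (one_le_chi hd q (by rw [← coe_criticalProbI]; exact hq2))
  have hfirst : 2 * (chi d q / n) = 2 / κ ^ 2 * s₁ ^ 2 * chi d q := by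
    rw [hs₁, mul_pow, ha2]; field_simp
  calc (bondPercolation (zdGraph d) (criticalProbI d)).real (clusterSizeGe (0 : Site d) n)
      ≤ 2 * (chi d q / n) + 256 * d / (pc * (1 - pc) ^ 2) * s₁ ^ 2 * chi d q := hmaster
    _ = (2 / κ ^ 2 + 256 * d / (pc * (1 - pc) ^ 2)) * s₁ ^ 2 * chi d q := by rw [hfirst]; ring

/-- **FACE E ⟹ the `1/log`-modulus of `θ` at `p_c⁺`, same exponent** (`d ≥ 2`): see the module docstring.  Explicit constant
`(256d/(p_c(1−p_c)²))·M`, explicit window `s₀ = min(δ₀, p_c, 1−p_c)/2`. [cite: Hutchcroft2022Triangle, §1.1] -/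
theorem logModulus_of_chiLogTwo (hd : 2 ≤ d) {M c δ₀ : ℝ}
    (hχ : ∀ q : unitInterval, (criticalProbI d : ℝ) - δ₀ < q → (q : ℝ) < criticalProbI d →
      chi d q ≤ M * ((criticalProbI d : ℝ) - q) ^ (-(2 : ℝ)) * (Real.log (1 / ((criticalProbI d : ℝ) - q))) ^ (-c)) :
    ∀ p : unitInterval, (criticalProbI d : ℝ) < p →
      (p : ℝ) ≤ criticalProbI d + min δ₀ (min (criticalProbI d : ℝ) (1 - criticalProbI d)) / 2 →
        theta (zdGraph d) 0 p ≤
          256 * d / ((criticalProbI d : ℝ) * (1 - criticalProbI d) ^ 2) * M *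
            (Real.log (1 / ((p : ℝ) - criticalProbI d))) ^ (-c) := by
  intro p hp1 hp2
  set pc : ℝ := (criticalProbI d : ℝ) with hpcdef
  have hd1 : 1 ≤ d := by omega
  have hpc0 : 0 < pc := by rw [hpcdef, coe_criticalProbI]; exact criticalProb_zd_pos d hd1
  have hpc1 : pc < 1 := by rw [hpcdef, coe_criticalProbI]; exact criticalProb_zd_lt_one hd
  set s : ℝ := (p : ℝ) - pc with hsdef
  have hs0 : 0 < s := by rw [hsdef]; linarith
  have hmin1 : min δ₀ (min pc (1 - pc)) ≤ δ₀ := min_le_left _ _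
  have hmin2 : min δ₀ (min pc (1 - pc)) ≤ pc := (min_le_right _ _).trans (min_le_left _ _)
  have hmin3 : min δ₀ (min pc (1 - pc)) ≤ 1 - pc := (min_le_right _ _).trans (min_le_right _ _)
  have hsδ : s < δ₀ := by rw [hsdef]; linarith
  have hs1 : s ≤ pc / 2 := by rw [hsdef]; linarith
  have hs2 : s ≤ (1 - pc) / 2 := by rw [hsdef]; linarith
  -- the subcritical point `q = p_c − s`
  have hqI : pc - s ∈ unitInterval := ⟨by linarith, by linarith⟩
  set q : unitInterval := ⟨pc - s, hqI⟩ with hqdef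
  have hqcoe : (q : ℝ) = pc - s := rfl
  have hθ := ThetaModulus.theta_le_sq_mul_chi_critical hd hs0 hs1 hs2 q (by rw [hqcoe]) p hp1.le
    (by rw [hsdef]; linarith)
  -- the hypothesis at `q`
  have hgap : pc - (q : ℝ) = s := by rw [hqcoe]; ring
  have hχq : chi d q ≤ M * s ^ (-(2 : ℝ)) * (Real.log (1 / s)) ^ (-c) := by
    have h := hχ q (by show pc - δ₀ < pc - s; linarith) (by show pc - s < pc; linarith)
    rwa [hgap] at h
  have hK0 : 0 ≤ 256 * d / (pc * (1 - pc) ^ 2) := by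
    have : 0 < pc * (1 - pc) ^ 2 := mul_pos hpc0 (pow_pos (by linarith) 2)
    positivity
  have hss : s ^ 2 * s ^ (-(2 : ℝ)) = 1 := by
    rw [← Real.rpow_natCast s 2, ← Real.rpow_add hs0]; norm_num
  calc theta (zdGraph d) 0 p ≤ 256 * d / (pc * (1 - pc) ^ 2) * s ^ 2 * chi d q := hθ
    _ ≤ 256 * d / (pc * (1 - pc) ^ 2) * s ^ 2 * (M * s ^ (-(2 : ℝ)) * (Real.log (1 / s)) ^ (-c)) :=
        mul_le_mul_of_nonneg_left hχq (by positivity)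
    _ = 256 * d / (pc * (1 - pc) ^ 2) * M * (s ^ 2 * s ^ (-(2 : ℝ))) * (Real.log (1 / s)) ^ (-c) := by ring
    _ = 256 * d / (pc * (1 - pc) ^ 2) * M * (Real.log (1 / s)) ^ (-c) := by rw [hss, mul_one]

end Summit.CriticalPhenomena.PercolationContinuityZ3.Theorems.Quant

end
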